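import Mathlib.NumberTheory.SmoothNumbers
import Mathlib.Data.Finset.Sym
import Mathlib.Algebra.Order.BigOperators.Ring.Finset
import Mathlib.Algebra.Order.BigOperators.GroupWithZero.Multiset
import Mathlib.Data.Real.Basic
import HarnessLib

/-!
# Smooth numbers with restricted prime factors: the Lenstra–Pomerance counting lemmas

For a finite set `Q` of primes write `ψ(x; Q)` for the number of integers `1 ≤ n ≤ x` all of whose
prime factors lie in `Q` (`Nat.factoredNumbers Q`); with `Q = {p ≤ y : p ∈ 𝒫}` this is the quantity
`ψ(x, y; 𝒫)` of Lenstra–Pomerance, *A rigorous time bound for factoring integers*, J. Amer. Math.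
Soc. **5** (1992), §6 ("smooth numbers with restricted prime factors"), whose Theorem 6.1 is the
lower bound for `ψ(x, y; 𝒫)` that drives the rigorous `L_n[1/2, 1 + o(1)]` analysis of the class
group relations method (Theorems 8.1 and 10.3 there); for `𝒫 =` all primes it is the
Canfield–Erdős–Pomerance lower bound `ψ(x, y) ≥ x · u^{-u(1+o(1))}`, `u = log x / log y`, in the
range `y ≤ exp((log x)^{1/2} (log log x)^η)`.

This file proves the three COMBINATORIAL steps of the proof of [LP92, Thm 6.1] (p. 499–500), in a
non-asymptotic form and for an arbitrary finite set of primes: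

* `card_sigma_le_card_factoredUpTo` — the two-stage injection `(M, n) ↦ (∏ M) · n` behind (6.6):
  if `R, T ⊆ Q` are disjoint sets of primes then
  `∑_{M ∈ T.sym k} ψ(⌊x / ∏ M⌋; R) ≤ ψ(x; Q)` (`M` runs over multisets of `k` primes of `T`);
* `card_sym_le_card_factoredUpTo` — products of `j` primes of `R` are distinct `R`-factored
  numbers, so `#(R.sym j) ≤ ψ(z; R)` as soon as all these products are `≤ z` (the count behind
  (6.10));
* `pow_sum_le_factorial_mul_sum_sym` — the "at most `k!` representations" inequality in the
  weighted form actually used: for `f ≥ 0` on a finite set `T`,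
  `(∑_{a ∈ T} f a)^k ≤ k! · ∑_{M ∈ T.sym k} ∏_{a ∈ M} f a` (power sums against complete homogeneous
  sums); with `f p = 1/p` this is `S^k / k! ≤ ∑_M 1/∏ M`, with `f = 1` it is `q^j / j! ≤ #(R.sym j)`.

The assembled lower bound (the analogue of (6.11)) is in
`Literature/NumberTheory/Sieve/SmoothNumbersRestrictedPrimesLowerBound.lean`.

Mathlib anchors: `Nat.factoredNumbers`, `Finset.sym`, `Sym`, `Nat.primeFactorsList_unique`.
Mathlib has upper bounds for smooth numbers (`Nat.smoothNumbersUpTo_card_le`) and the tree has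
Rankin's upper bound (`Literature.NumberTheory.Sieve.card_smoothNumbersUpTo_le_rankin`); lower
bounds were missing.

## References

* H. W. Lenstra Jr., C. Pomerance, *A rigorous time bound for factoring integers*, J. Amer. Math.
  Soc. 5 (1992) 483–516, §6, Theorem 6.1 and its proof, (6.6)–(6.11). [LenstraPomerance1992]
* E. R. Canfield, P. Erdős, C. Pomerance, *On a problem of Oppenheim concerning "factorisatio
  numerorum"*, J. Number Theory 17 (1983) 1–28 (the lower bound `ψ(x, y) ≥ x u^{-u(1+o(1))}`).
-/

namespace Literature.NumberTheory.Sieve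

open Finset

/-! ### `ψ(x; Q)`: `Q`-factored numbers up to `x` -/

/-- `factoredUpTo Q x`: the finite set of integers `1 ≤ n ≤ x` all of whose prime factors lie in
`Q` (i.e. `n ∈ Nat.factoredNumbers Q`). Its cardinality is `ψ(x; Q)`; for
`Q = {p ≤ y : p ∈ 𝒫}` this is Lenstra–Pomerance's `ψ(x, y; 𝒫)`, and for `Q =` all primes `≤ y` it
is the smooth-number count `ψ(x, y)`. [cite: LenstraPomerance1992, §6 p. 499] -/
def factoredUpTo (Q : Finset ℕ) (x : ℕ) : Finset ℕ :=
  (Finset.Icc 1 x).filter (· ∈ Nat.factoredNumbers Q)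

/-- Membership in `factoredUpTo Q x`: `n ≤ x` and `n` is `Q`-factored (which forces `n ≠ 0`).
[cite: LenstraPomerance1992, §6] -/
theorem mem_factoredUpTo {Q : Finset ℕ} {x n : ℕ} :
    n ∈ factoredUpTo Q x ↔ n ≤ x ∧ n ∈ Nat.factoredNumbers Q := by
  simp only [factoredUpTo, mem_filter, mem_Icc]
  constructor
  · rintro ⟨⟨-, h⟩, h'⟩
    exact ⟨h, h'⟩
  · rintro ⟨h, h'⟩
    exact ⟨⟨Nat.one_le_iff_ne_zero.2 h'.1, h⟩, h'⟩

/-- `factoredUpTo` is monotone in the set of allowed primes. [folklore] -/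
theorem factoredUpTo_mono {Q Q' : Finset ℕ} (h : Q ⊆ Q') (x : ℕ) :
    factoredUpTo Q x ⊆ factoredUpTo Q' x := fun n hn => by
  rw [mem_factoredUpTo] at hn ⊢
  exact ⟨hn.1, hn.2.1, fun p hp => h (hn.2.2 p hp)⟩

/-- `1` is counted as soon as `1 ≤ x`. [folklore] -/
theorem one_mem_factoredUpTo {Q : Finset ℕ} {x : ℕ} (hx : 1 ≤ x) : 1 ∈ factoredUpTo Q x :=
  mem_factoredUpTo.2 ⟨hx, one_ne_zero, by simp [Nat.primeFactorsList_one]⟩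

/-- `ψ(x; Q) ≤ x`. [folklore] -/
theorem card_factoredUpTo_le (Q : Finset ℕ) (x : ℕ) : #(factoredUpTo Q x) ≤ x :=
  (card_le_card (filter_subset _ _)).trans (by simp)

/-! ### Products of multisets of primes -/

/-- The product of a multiset of primes taken from `T` is nonzero. [folklore] -/
theorem sym_prod_ne_zero {T : Finset ℕ} (hT : ∀ p ∈ T, p.Prime) {k : ℕ} {M : Sym ℕ k}
    (hM : M ∈ T.sym k) : (M : Multiset ℕ).prod ≠ 0 :=
  Multiset.prod_ne_zero fun h0 => (hT 0 (mem_sym_iff.1 hM 0 h0)).ne_zero rfl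

/-- The product of a multiset of primes taken from `T` is a `T`-factored number. [folklore] -/
theorem sym_prod_mem_factoredNumbers {T : Finset ℕ} (hT : ∀ p ∈ T, p.Prime) {k : ℕ}
    {M : Sym ℕ k} (hM : M ∈ T.sym k) : (M : Multiset ℕ).prod ∈ Nat.factoredNumbers T := by
  rw [Nat.mem_factoredNumbers']
  intro p hp hdvd
  obtain ⟨q, hqM, hpq⟩ := (Nat.Prime.prime hp).exists_mem_multiset_dvd hdvd
  have hqT : q ∈ T := mem_sym_iff.1 hM q hqM
  rwa [(Nat.prime_dvd_prime_iff_eq hp (hT q hqT)).1 hpq]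

/-- Unique factorisation: two multisets of `k` primes with the same product are equal.
[folklore] -/
theorem sym_eq_of_prod_eq {T : Finset ℕ} (hT : ∀ p ∈ T, p.Prime) {k : ℕ} {M M' : Sym ℕ k}
    (hM : M ∈ T.sym k) (hM' : M' ∈ T.sym k)
    (h : (M : Multiset ℕ).prod = (M' : Multiset ℕ).prod) : M = M' := by
  apply Sym.coe_injective
  have h1 : (M : Multiset ℕ).toList.Perm ((M : Multiset ℕ).prod).primeFactorsList :=
    Nat.primeFactorsList_unique (by rw [Multiset.prod_toList])
      fun p hp => hT p (mem_sym_iff.1 hM p (Multiset.mem_toList.1 hp))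
  have h2 : (M' : Multiset ℕ).toList.Perm ((M' : Multiset ℕ).prod).primeFactorsList :=
    Nat.primeFactorsList_unique (by rw [Multiset.prod_toList])
      fun p hp => hT p (mem_sym_iff.1 hM' p (Multiset.mem_toList.1 hp))
  rw [h] at h1
  have h3 := Multiset.coe_eq_coe.2 (h1.trans h2.symm)
  rwa [Multiset.coe_toList, Multiset.coe_toList] at h3

/-- A multiset of `k` numbers from `T`, all `≤ y`, has product `≤ y ^ k`. [folklore] -/
theorem sym_prod_le_pow {T : Finset ℕ} {y : ℕ} (hTy : ∀ p ∈ T, p ≤ y) {k : ℕ} {M : Sym ℕ k}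
    (hM : M ∈ T.sym k) : (M : Multiset ℕ).prod ≤ y ^ k := by
  have h := Multiset.prod_le_pow_card (M : Multiset ℕ) y fun p hp => hTy p (mem_sym_iff.1 hM p hp)
  rwa [Sym.card_coe] at h

/-- A multiset of `k` numbers from `T`, all `≥ v`, has product `≥ v ^ k`. [folklore] -/
theorem pow_le_sym_prod {T : Finset ℕ} {v : ℕ} (hTv : ∀ p ∈ T, v ≤ p) {k : ℕ} {M : Sym ℕ k}
    (hM : M ∈ T.sym k) : v ^ k ≤ (M : Multiset ℕ).prod := by
  have h := Multiset.pow_card_le_prod (s := (M : Multiset ℕ)) (a := v)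
    fun p hp => hTv p (mem_sym_iff.1 hM p hp)
  rwa [Sym.card_coe] at h

/-! ### Stage two: products of `j` small primes are distinct smooth numbers ((6.10) of the paper) -/

/-- If every product of `j` primes of `R` is at most `z`, then `#(R.sym j) ≤ ψ(z; R)`: the product
map is injective on multisets of primes (unique factorisation) and lands in the `R`-factored
numbers `≤ z`. This is the counting step "considering all products of `[l]` not necessarily
distinct primes `p ∈ 𝒫` with `p ≤ w` … no integer has more than `[l]!` representations" of the
proof of [LP92, Thm 6.1], in injective (multiset) form.
[cite: LenstraPomerance1992, §6 proof of Thm 6.1 (6.10)] -/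
theorem card_sym_le_card_factoredUpTo {R : Finset ℕ} (hR : ∀ p ∈ R, p.Prime) {j z : ℕ}
    (hz : ∀ M ∈ R.sym j, (M : Multiset ℕ).prod ≤ z) :
    #(R.sym j) ≤ #(factoredUpTo R z) := by
  refine card_le_card_of_injOn (fun M => (M : Multiset ℕ).prod) (fun M hM => ?_)
    (fun M hM M' hM' h => sym_eq_of_prod_eq hR hM hM' h)
  exact mem_coe.2 (mem_factoredUpTo.2 ⟨hz M hM, sym_prod_mem_factoredNumbers hR hM⟩)

/-- Variant with a uniform bound on the primes: if all primes of `R` are `≤ w` and `w ^ j ≤ z` then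
`#(R.sym j) ≤ ψ(z; R)`. [cite: LenstraPomerance1992, §6 proof of Thm 6.1 (6.10)] -/
theorem card_sym_le_card_factoredUpTo_of_pow_le {R : Finset ℕ} (hR : ∀ p ∈ R, p.Prime) {w j z : ℕ}
    (hRw : ∀ p ∈ R, p ≤ w) (hwz : w ^ j ≤ z) :
    #(R.sym j) ≤ #(factoredUpTo R z) :=
  card_sym_le_card_factoredUpTo hR fun _ hM => (sym_prod_le_pow hRw hM).trans hwz

/-! ### Stage one: the two-stage injection ((6.6) of the paper) -/

/-- A `T`-factored number and an `R`-factored number are coprime when `R` and `T` are disjoint.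
[folklore] -/
theorem coprime_of_mem_factoredNumbers_of_disjoint {R T : Finset ℕ} (hRT : Disjoint R T)
    {m n : ℕ} (hm : m ∈ Nat.factoredNumbers T) (hn : n ∈ Nat.factoredNumbers R) :
    Nat.Coprime m n := by
  rw [Nat.mem_factoredNumbers'] at hm hn
  exact Nat.coprime_of_dvd fun p hp hpm hpn => disjoint_left.1 hRT (hn p hp hpn) (hm p hp hpm)

/-- **Two-stage injection** [LP92, (6.6)]. Let `R, T ⊆ Q` be finite sets of primes with `R ∩ T = ∅`.
Then `∑_{M ∈ T.sym k} ψ(⌊x / ∏ M⌋; R) ≤ ψ(x; Q)`: the map `(M, n) ↦ (∏ M) · n` from pairs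
(multiset of `k` primes of `T`, `R`-factored `n ≤ x / ∏ M`) to `Q`-factored numbers `≤ x` is
injective, because `∏ M` is recovered as the `T`-part of the product (coprimality) and `M` from
`∏ M` (unique factorisation). In the paper `T = {p ∈ 𝒫 : v < p ≤ y}`, `R = {p ∈ 𝒫 : p ≤ w}`
with `w ≤ v`, and `k = [u]`. [cite: LenstraPomerance1992, §6 proof of Thm 6.1 (6.6)] -/
theorem sum_card_factoredUpTo_div_le {Q R T : Finset ℕ} (hT : ∀ p ∈ T, p.Prime) (hTQ : T ⊆ Q)
    (hRQ : R ⊆ Q) (hRT : Disjoint R T) (x k : ℕ) :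
    ∑ M ∈ T.sym k, #(factoredUpTo R (x / (M : Multiset ℕ).prod)) ≤ #(factoredUpTo Q x) := by
  rw [← card_sigma]
  refine card_le_card_of_injOn (fun z => (z.1 : Multiset ℕ).prod * z.2) ?_ ?_
  · rintro ⟨M, n⟩ hz
    obtain ⟨hM, hn⟩ := mem_sigma.1 (mem_coe.1 hz)
    obtain ⟨hnx, hnR⟩ := mem_factoredUpTo.1 hn
    have h0 : 0 < (M : Multiset ℕ).prod := Nat.pos_of_ne_zero (sym_prod_ne_zero hT hM)
    refine mem_coe.2 (mem_factoredUpTo.2 ⟨?_, ?_⟩)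
    · have := (Nat.le_div_iff_mul_le h0).1 hnx
      simpa [mul_comm] using this
    · have hMQ : (M : Multiset ℕ).prod ∈ Nat.factoredNumbers Q :=
        let h := sym_prod_mem_factoredNumbers hT hM
        ⟨h.1, fun p hp => hTQ (h.2 p hp)⟩
      exact Nat.mul_mem_factoredNumbers hMQ ⟨hnR.1, fun p hp => hRQ (hnR.2 p hp)⟩
  · rintro ⟨M, n⟩ hz ⟨M', n'⟩ hz' heq
    obtain ⟨hM, hn⟩ := mem_sigma.1 (mem_coe.1 hz)
    obtain ⟨hM', hn'⟩ := mem_sigma.1 (mem_coe.1 hz')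
    have hnR := (mem_factoredUpTo.1 hn).2
    have hnR' := (mem_factoredUpTo.1 hn').2
    simp only at heq
    have hc : Nat.Coprime (M : Multiset ℕ).prod n' :=
      coprime_of_mem_factoredNumbers_of_disjoint hRT (sym_prod_mem_factoredNumbers hT hM) hnR'
    have hc' : Nat.Coprime (M' : Multiset ℕ).prod n :=
      coprime_of_mem_factoredNumbers_of_disjoint hRT (sym_prod_mem_factoredNumbers hT hM') hnR
    have h1 : (M : Multiset ℕ).prod ∣ (M' : Multiset ℕ).prod :=
      hc.dvd_of_dvd_mul_right (heq ▸ dvd_mul_right _ _)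
    have h2 : (M' : Multiset ℕ).prod ∣ (M : Multiset ℕ).prod :=
      hc'.dvd_of_dvd_mul_right (heq ▸ dvd_mul_right _ _)
    have hMM' : M = M' := sym_eq_of_prod_eq hT hM hM' (Nat.dvd_antisymm h1 h2)
    subst hMM'
    have hnn' : n = n' := mul_left_cancel₀ (sym_prod_ne_zero hT hM) heq
    subst hnn'
    rfl

/-! ### Power sums against complete homogeneous sums ("at most `k!` representations") -/

/-- Fibre count: every multiset `M'` of size `k + 1` arises as `a ::ₛ M` from at most `k + 1` pairs
`(a, M)`. Hence for `G ≥ 0`,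
`∑_{(a, M) ∈ T × T.sym k} G (a ::ₛ M) ≤ (k + 1) · ∑_{M' ∈ T.sym (k+1)} G M'`. [folklore] -/
theorem sum_prod_sym_cons_le {α : Type*} [DecidableEq α] (T : Finset α) (k : ℕ)
    (G : Sym α (k + 1) → ℝ) (hG : ∀ M ∈ T.sym (k + 1), 0 ≤ G M) :
    ∑ p ∈ T ×ˢ T.sym k, G (p.1 ::ₛ p.2) ≤ (k + 1) * ∑ M ∈ T.sym (k + 1), G M := by
  have hmaps : ∀ p ∈ T ×ˢ T.sym k, p.1 ::ₛ p.2 ∈ T.sym (k + 1) := by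
    rintro ⟨a, M⟩ hp
    obtain ⟨ha, hM⟩ := mem_product.1 hp
    rw [mem_sym_iff]
    intro b hb
    rcases Sym.mem_cons.1 hb with rfl | hb
    · exact ha
    · exact mem_sym_iff.1 hM b hb
  rw [← sum_fiberwise_of_maps_to' hmaps, mul_sum]
  refine sum_le_sum fun M' hM' => ?_
  rw [sum_const, nsmul_eq_mul]
  refine mul_le_mul_of_nonneg_right ?_ (hG M' hM')
  have hcard : #({p ∈ T ×ˢ T.sym k | p.1 ::ₛ p.2 = M'}) ≤ #((M' : Multiset α).toFinset) := by
    refine card_le_card_of_injOn Prod.fst ?_ ?_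
    · rintro ⟨a, M⟩ hp
      have h := (mem_filter.1 (mem_coe.1 hp)).2
      simp only at h
      rw [mem_coe, Multiset.mem_toFinset, ← h]
      exact Sym.mem_cons_self a M
    · rintro ⟨a, M⟩ hp ⟨a', M''⟩ hp' (rfl : a = a')
      have h := (mem_filter.1 (mem_coe.1 hp)).2
      have h' := (mem_filter.1 (mem_coe.1 hp')).2
      simp only at h h'
      rw [← h', Sym.cons_inj_right] at h
      rw [h]
  have hfin : #((M' : Multiset α).toFinset) ≤ k + 1 :=
    (Multiset.toFinset_card_le _).trans (by rw [Sym.card_coe])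
  exact_mod_cast hcard.trans hfin

/-- **Power sums against complete homogeneous sums.** For `f ≥ 0` on a finite set `T` and every
`k`, `(∑_{a ∈ T} f a) ^ k ≤ k! · ∑_{M ∈ T.sym k} ∏_{a ∈ M} f a` (the sum over multisets of size `k`,
with multiplicity, i.e. the complete homogeneous symmetric polynomial `h_k`). Expanding the power,
each multiset `M` collects at most `k!` ordered `k`-tuples — the inequality "no integer has more than
`[u]!` representations as a product of `[u]` primes" of [LP92, proof of Thm 6.1], in weighted form.
Proved by induction on `k` from `sum_prod_sym_cons_le`. [cite: LenstraPomerance1992, §6 proof of Thm 6.1] -/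
theorem pow_sum_le_factorial_mul_sum_sym {α : Type*} [DecidableEq α] (T : Finset α) (f : α → ℝ)
    (hf : ∀ a ∈ T, 0 ≤ f a) (k : ℕ) :
    (∑ a ∈ T, f a) ^ k ≤ (k.factorial : ℝ) * ∑ M ∈ T.sym k, ((M : Multiset α).map f).prod := by
  induction k with
  | zero => simp [show ((∅ : Sym α 0) : Multiset α) = 0 from rfl]
  | succ k ih =>
    have hS : 0 ≤ ∑ a ∈ T, f a := sum_nonneg hf
    have hF : ∀ (n : ℕ) (M : Sym α n), M ∈ T.sym n → 0 ≤ ((M : Multiset α).map f).prod :=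
      fun n M hM => Multiset.prod_nonneg fun x hx => by
        obtain ⟨a, ha, rfl⟩ := Multiset.mem_map.1 hx
        exact hf a (mem_sym_iff.1 hM a ha)
    calc (∑ a ∈ T, f a) ^ (k + 1) = (∑ a ∈ T, f a) * (∑ a ∈ T, f a) ^ k := by ring
      _ ≤ (∑ a ∈ T, f a) * ((k.factorial : ℝ) * ∑ M ∈ T.sym k, ((M : Multiset α).map f).prod) :=
          mul_le_mul_of_nonneg_left ih hS
      _ = (k.factorial : ℝ) * ∑ p ∈ T ×ˢ T.sym k, ((↑(p.1 ::ₛ p.2) : Multiset α).map f).prod := by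
          rw [sum_product]
          simp_rw [Sym.coe_cons, Multiset.map_cons, Multiset.prod_cons]
          rw [← sum_mul_sum]
          ring
      _ ≤ (k.factorial : ℝ) * ((k + 1) * ∑ M ∈ T.sym (k + 1), ((M : Multiset α).map f).prod) :=
          mul_le_mul_of_nonneg_left
            (sum_prod_sym_cons_le T k (fun M => ((M : Multiset α).map f).prod) (hF (k + 1)))
            (Nat.cast_nonneg _)
      _ = ((k + 1).factorial : ℝ) * ∑ M ∈ T.sym (k + 1), ((M : Multiset α).map f).prod := by
          rw [Nat.factorial_succ, Nat.cast_mul]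
          push_cast
          ring

/-- The case `f = 1`: `q ^ j ≤ j! · #(R.sym j)` where `q = #R` (so `#(R.sym j) ≥ q^j / j!`, the count
of products of `j` not necessarily distinct primes used in (6.10)). [cite: LenstraPomerance1992, §6 proof of Thm 6.1 (6.10)] -/
theorem card_pow_le_factorial_mul_card_sym {α : Type*} [DecidableEq α] (R : Finset α) (j : ℕ) :
    ((#R : ℕ) : ℝ) ^ j ≤ (j.factorial : ℝ) * #(R.sym j) := by
  have h := pow_sum_le_factorial_mul_sum_sym R (fun _ => (1 : ℝ)) (fun _ _ => zero_le_one) j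
  simpa using h

/-- The case `f p = 1/p`: `S ^ k ≤ k! · ∑_{M ∈ T.sym k} 1 / ∏ M` with `S = ∑_{p ∈ T} 1/p`, i.e. the
inequality `∑_{m ∈ 𝓜} 1/m ≥ S^{[u]} / [u]!` of the proof of [LP92, Thm 6.1] (there with
`S = S(v, y; 𝒫)`). [cite: LenstraPomerance1992, §6 proof of Thm 6.1] -/
theorem inv_sum_pow_le_factorial_mul_sum_sym_inv_prod (T : Finset ℕ) (k : ℕ) :
    (∑ p ∈ T, (p : ℝ)⁻¹) ^ k ≤
      (k.factorial : ℝ) * ∑ M ∈ T.sym k, (((M : Multiset ℕ).prod : ℕ) : ℝ)⁻¹ := by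
  have h := pow_sum_le_factorial_mul_sum_sym T (fun p => (p : ℝ)⁻¹)
    (fun p _ => inv_nonneg.2 (Nat.cast_nonneg p)) k
  refine h.trans (le_of_eq ?_)
  congr 1
  refine sum_congr rfl fun M _ => ?_
  rw [Multiset.prod_map_inv, Nat.cast_multiset_prod]

end Literature.NumberTheory.Sieve
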